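import Summits.HodgeConjecture.CorCM.MumfordTateRankRibetTypeOnePairsRigidDistinctFields
import Literature.AlgebraicGeometry.Motives.HodgeLieRigidOfCenterRankLeOne
import HarnessLib

/-!
# A Ribet-type abelian variety times ANY abelian variety without factors of type IV: `H¹(A × B)` is `Θ`-rigid
# (the centre of `Lie Hg(H¹(A × B))` lies on the line `ℚ ι₁φ^*π₁`, and `tr((ι₁φ^*π₁)_ℂ Θ) = ±2(g − 2) i√d ≠ 0`)

COR-CM (cell `pub-hodgecm2`, seat `b27` gen 54, count-neutral Mumford–Tate-rank ladder; theorems only, no definition, no named fact; UNCONDITIONAL —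
nothing here uses or asserts HC_CM).  An instance of gen 54ʼs «centre of rank `≤ 1`» criterion (`Motives/HodgeLieRigidOfCenterRankLeOne`): for
`A` of Ribet type `(g−1,1)` (`g ≥ 3`, `φ ∘ φ = −d`, `dim_ℚ End⁰A = 2`, multiplicity one at `±i√d`) and `B` with NO simple factor of type IV
(`HasNoTypeIVFactor B`, Moonen–Zarhin §1), every `ψ`-skew central Hodge endomorphism of `H¹(A × B)` is block diagonal with blocks in
`ℚφ^*` (the skew centre of `Lie Hg(H¹A)`, `ribetTypeOne_factor_data`) and in `Lie Hg(H¹B) ∩ End_Hdg(H¹B) = 0`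
(`hodgeLie_hodge_one_inf_endAlg_eq_bot_of_hasNoTypeIVFactor`); so `dim 𝔷(Lie Hg(H¹(A × B))) ≤ 1`, while the Hodge endomorphism `ι₁φ^*π₁`
has `tr((ι₁φ^*π₁)_ℂ Θ) = tr(Θ_A φ^*) = ±2(g−2)i√d ≠ 0`.
* **`hodgeLie_rigid_ribetTypeOne_prod_of_hasNoTypeIVFactor`** — `H¹(A × B)` is `Θ`-rigid;
* **`mtRank_hodge_one_le_of_isIsogenous_ribetTypeOne_prod_prod`** — `t(X) ≥ t(A × B)` for every `X ∼ (A × B) × Y`.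

## References
* [MoonenZarhin1999LowDim] B. Moonen, Yu. G. Zarhin, *Hodge classes on abelian varieties of low dimension*, Math. Ann. 315 (1999), §1, §3 (3.1)
  [corpus: paper:arxiv-math_9901113 pp. 2, 6]. [cite: MoonenZarhin1999LowDim, §3 (3.1)]
* [Deligne1982HodgeCycles] P. Deligne, LNM 900 (1982), I §3 Prop. 3.6. [cite: Deligne1982HodgeCycles, I §3 Prop. 3.6]
* [Ribet1983] K. A. Ribet, Amer. J. Math. 105 (1983), Thm. 3. [cite: Ribet1983, Thm. 3]
* [Gordon1997] B. B. Gordon, *A survey of the Hodge conjecture for abelian varieties*, 1.13.2. [cite: Gordon1997, 1.13.2]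
-/

noncomputable section

open scoped TensorProduct
open CategoryTheory CategoryTheory.Limits Module NumberField

namespace Summit.HodgeConjecture.CorCM

open Literature.AlgebraicGeometry.Motives
open Literature.AlgebraicGeometry.Motives.AbelianVariety
open Literature.AlgebraicGeometry.Motives.HodgeStructure
open Literature.AlgebraicGeometry.HodgeTheory
open Literature.AlgebraicGeometry.ComplexMultiplication

variable [HodgeTensorFacts.{0, 0}] {X : AbelianVariety ℂ} {n : ℕ}

set_option maxHeartbeats 1600000 in
/-- **`H¹(A × B)` is `Θ`-rigid for `A` of Ribet type `(g−1,1)` (`g ≥ 3`) and `B` with no simple factor of type IV**: the centre of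
`Lie Hg(H¹(A × B))` lies on `ℚ ι₁φ^*π₁` and `tr((ι₁φ^*π₁)_ℂ Θ) ≠ 0` (`rigid_of_finrank_center_le_one`).
[cite: MoonenZarhin1999LowDim, §3 (3.1)] [cite: Deligne1982HodgeCycles, I §3 Prop. 3.6] [cite: Ribet1983, Thm. 3] [cite: Gordon1997, 1.13.2] -/
theorem hodgeLie_rigid_ribetTypeOne_prod_of_hasNoTypeIVFactor {A B : AbelianVariety ℂ} {m : ℕ} (hP : IsSmoothProjective m (A.prod B).X)
    (φ : A ⟶ A) {d : ℕ} (hd : 0 < d) (hφ : φ ≫ φ = -(d • 𝟙 A)) (hAE : Module.finrank ℚ A.endAlgebra = 2)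
    (h1 : eigenMultiplicity A φ (Complex.I * (Real.sqrt d : ℂ)) = 1 ∨ eigenMultiplicity A φ (-(Complex.I * (Real.sqrt d : ℂ))) = 1) (hdim : 3 ≤ A.dim)
    (hB4 : HasNoTypeIVFactor B) :
    haveI := BettiUniverse.finite hP 1
    ∀ 𝔞 : Submodule ℚ (Module.End ℚ (bettiCohomology (A.prod B).X 1)),
      𝔞 ≤ (BettiUniverse.hodge exists_isReal_hodgeModel_holds hP 1).hodgeLie →
      (∀ X' ∈ 𝔞, ∀ Y ∈ 𝔞, X' * Y - Y * X' ∈ 𝔞) →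
      (∃ Θ ∈ Submodule.span ℂ ((fun X' : Module.End ℚ (bettiCohomology (A.prod B).X 1) => X'.baseChange ℂ) ''
          (𝔞 : Set (Module.End ℚ (bettiCohomology (A.prod B).X 1)))),
        ∀ p, ∀ x ∈ (BettiUniverse.hodge exists_isReal_hodgeModel_holds hP 1).piece p (((1 : ℕ) : ℤ) - p),
          Θ x = ((2 * p - ((1 : ℕ) : ℤ) : ℤ) : ℂ) • x) →
      (BettiUniverse.hodge exists_isReal_hodgeModel_holds hP 1).hodgeLie ≤ 𝔞 := by
  classical
  have hnP : (A.prod B).dim = m := schemeDim_eq_holds hP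
  subst hnP
  have hT : IsSmoothProjective A.dim A.X := AbelianVariety.isSmoothProjective_holds
  have hT' : IsSmoothProjective B.dim B.X := AbelianVariety.isSmoothProjective_holds
  haveI := BettiUniverse.finite hP 1
  haveI := BettiUniverse.finite hT 1
  haveI := BettiUniverse.finite hT' 1
  -- per-factor data
  obtain ⟨μ₁, k₁, hφ₁E, hφ₁2, hE₁, hμ₁, h1₁, h2₁, hφ₁𝔥, hZ₁, hσ₁, hk₁, hτ₁⟩ := ribetTypeOne_factor_data hT φ hd hφ hAE h1 hdim
  have hZ₂ := hodgeLie_hodge_one_inf_endAlg_eq_bot_of_hasNoTypeIVFactor hT' hB4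
  set φ₁ : Module.End ℚ (bettiCohomology A.X 1) := (bettiCohomology.map φ.hom.hom.hom 1).hom with hφ₁
  set H := BettiUniverse.hodge exists_isReal_hodgeModel_holds hP 1 with hHdef
  set H₁ := BettiUniverse.hodge exists_isReal_hodgeModel_holds hT 1 with hH₁def
  set H₂ := BettiUniverse.hodge exists_isReal_hodgeModel_holds hT' 1 with hH₂def
  obtain ⟨ψ₁⟩ := BettiUniverse.hodge_isPolarizable exists_isReal_hodgeModel_holds hT 1
  obtain ⟨ψ⟩ := BettiUniverse.hodge_isPolarizable exists_isReal_hodgeModel_holds hP 1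
  -- the bicone of `H¹(A × B)`
  let ι₁ := BettiUniverse.pullHodgeHom exists_isReal_hodgeModel_holds hodgePQ_independent_of_hodgeModel_holds hP hT (fst A B).hom.hom.hom 1
  let π₁ := BettiUniverse.pullHodgeHom exists_isReal_hodgeModel_holds hodgePQ_independent_of_hodgeModel_holds hT hP
    (prodLift (𝟙 A) (0 : A ⟶ B)).hom.hom.hom 1
  let ι₂ := BettiUniverse.pullHodgeHom exists_isReal_hodgeModel_holds hodgePQ_independent_of_hodgeModel_holds hP hT' (snd A B).hom.hom.hom 1
  let π₂ := BettiUniverse.pullHodgeHom exists_isReal_hodgeModel_holds hodgePQ_independent_of_hodgeModel_holds hT' hP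
    (prodLift (0 : B ⟶ A) (𝟙 B)).hom.hom.hom 1
  have hsumP : fst A B ≫ prodLift (𝟙 A) (0 : A ⟶ B) + snd A B ≫ prodLift (0 : B ⟶ A) (𝟙 B) = 𝟙 _ := by
    refine prod_hom_ext ?_ ?_
    · rw [Preadditive.add_comp, Category.assoc, Category.assoc, prodLift_fst, prodLift_fst, Category.comp_id, comp_zero, add_zero, Category.id_comp]
    · rw [Preadditive.add_comp, Category.assoc, Category.assoc, prodLift_snd, prodLift_snd, Category.comp_id, comp_zero, zero_add, Category.id_comp]
  have hπι₁ : ∀ v, π₁.toLinearMap (ι₁.toLinearMap v) = v := fun v => pull_pull_eq_self_of_comp_eq_id (prodLift_fst _ _) v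
  have hπι₂ : ∀ v, π₂.toLinearMap (ι₂.toLinearMap v) = v := fun v => pull_pull_eq_self_of_comp_eq_id (prodLift_snd _ _) v
  have hsum : ∀ v, ι₁.toLinearMap (π₁.toLinearMap v) + ι₂.toLinearMap (π₂.toLinearMap v) = v := fun v =>
    pull_pull_add_pull_pull_eq_self _ _ _ _ hsumP v
  -- the skew centre of `Lie Hg(H¹(A × B))` is on the line `ℚ ι₁φ₁π₁`
  set E₁ : Module.End ℚ (bettiCohomology (A.prod B).X 1) := ι₁.toLinearMap ∘ₗ φ₁ ∘ₗ π₁.toLinearMap with hE₁def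
  have hZ : ∀ z ∈ H.hodgeLie ⊓ Subalgebra.toSubmodule H.endAlg, ∃ x₁ : ℚ, z = x₁ • E₁ := by
    intro z hz
    obtain ⟨hz𝔥, hzE⟩ := Submodule.mem_inf.1 hz
    rw [Subalgebra.mem_toSubmodule] at hzE
    have hb := eq_sum_blocks_of_mem_hodgeLie ι₁ π₁ ι₂ π₂ hπι₁ hπι₂ hsum hz𝔥
    obtain ⟨x₁, hx₁⟩ := hZ₁ ψ₁ _ (Submodule.mem_inf.2 ⟨comp_mem_hodgeLie_of_retract ι₁ π₁ hπι₁ hz𝔥,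
      ((π₁.comp (endAlg.toHom ⟨z, hzE⟩)).comp ι₁).toLinearMap_mem_endAlg⟩)
    have hx₂ : π₂.toLinearMap ∘ₗ z ∘ₗ ι₂.toLinearMap = 0 := by
      have h : π₂.toLinearMap ∘ₗ z ∘ₗ ι₂.toLinearMap ∈ H₂.hodgeLie ⊓ Subalgebra.toSubmodule H₂.endAlg :=
        Submodule.mem_inf.2 ⟨comp_mem_hodgeLie_of_retract ι₂ π₂ hπι₂ hz𝔥, ((π₂.comp (endAlg.toHom ⟨z, hzE⟩)).comp ι₂).toLinearMap_mem_endAlg⟩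
      rw [hH₂def, hZ₂, Submodule.mem_bot] at h
      exact h
    refine ⟨x₁, ?_⟩
    rw [hb, hx₁, hx₂]
    simp only [LinearMap.smul_comp, LinearMap.comp_smul, LinearMap.comp_zero, LinearMap.zero_comp, add_zero, hE₁def]
  set P : Submodule ℚ (Module.End ℚ (bettiCohomology (A.prod B).X 1)) :=
    Submodule.span ℚ ((({E₁} : Finset (Module.End ℚ (bettiCohomology (A.prod B).X 1))) : Set _)) with hPdef
  have hE₁P : E₁ ∈ P := Submodule.subset_span (by rw [Finset.coe_singleton]; exact Set.mem_singleton _)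
  have h𝔷le : H.hodgeLie ⊓ Subalgebra.toSubmodule H.endAlg ≤ P := by
    intro z hz
    obtain ⟨x₁, rfl⟩ := hZ z hz
    exact P.smul_mem _ hE₁P
  have h𝔷1 : Module.finrank ℚ ↥(H.hodgeLie ⊓ Subalgebra.toSubmodule H.endAlg) ≤ 1 :=
    (Submodule.finrank_mono h𝔷le).trans ((finrank_span_finset_le_card _).trans (Finset.card_singleton _).le)
  -- the Hodge endomorphism `E₁` is not trace-orthogonal to `Θ`
  have hE₁E : E₁ ∈ H.endAlg := ((ι₁.comp (endAlg.toHom ⟨φ₁, hφ₁E⟩)).comp π₁).toLinearMap_mem_endAlg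
  obtain ⟨Θ₀, hΘ₀⟩ := exists_hodgeTheta H
  have hπιC : ∀ y, π₁.toLinearMap.baseChange ℂ (ι₁.toLinearMap.baseChange ℂ y) = y := fun y => by
    have h := congrArg (LinearMap.baseChange ℂ) (LinearMap.ext hπι₁ : π₁.toLinearMap ∘ₗ ι₁.toLinearMap = LinearMap.id)
    rw [LinearMap.baseChange_comp, LinearMap.baseChange_id] at h
    exact LinearMap.congr_fun h y
  have hΘ₁ : ∀ p, ∀ x ∈ H₁.piece p (((1 : ℕ) : ℤ) - p),
      (π₁.toLinearMap.baseChange ℂ ∘ₗ Θ₀ ∘ₗ ι₁.toLinearMap.baseChange ℂ) x = ((2 * p - ((1 : ℕ) : ℤ) : ℤ) : ℂ) • x := by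
    intro p x hx
    have hιx : ι₁.toLinearMap.baseChange ℂ x ∈ H.piece p (((1 : ℕ) : ℤ) - p) := Hom.map_piece_le ι₁ p _ ⟨x, hx, rfl⟩
    rw [LinearMap.comp_apply, LinearMap.comp_apply, hΘ₀ p _ hιx, map_smul, hπιC]
  have htr : LinearMap.trace ℂ _ (E₁.baseChange ℂ * Θ₀) = (Complex.I * (Real.sqrt d : ℂ)) * k₁ := by
    rw [← hτ₁ _ hΘ₁]
    have e1 : E₁.baseChange ℂ * Θ₀ =
        ι₁.toLinearMap.baseChange ℂ ∘ₗ (φ₁.baseChange ℂ ∘ₗ π₁.toLinearMap.baseChange ℂ ∘ₗ Θ₀) := by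
      rw [hE₁def, LinearMap.baseChange_comp, LinearMap.baseChange_comp]; rfl
    have e2 : (φ₁.baseChange ℂ ∘ₗ π₁.toLinearMap.baseChange ℂ ∘ₗ Θ₀) ∘ₗ ι₁.toLinearMap.baseChange ℂ =
        φ₁.baseChange ℂ * (π₁.toLinearMap.baseChange ℂ ∘ₗ Θ₀ ∘ₗ ι₁.toLinearMap.baseChange ℂ) := rfl
    rw [e1, LinearMap.trace_comp_comm', e2, LinearMap.trace_mul_comm]
  have hcΘ : LinearMap.trace ℂ _ (E₁.baseChange ℂ * Θ₀) ≠ 0 := by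
    rw [htr]
    refine mul_ne_zero (mul_ne_zero Complex.I_ne_zero ?_) (by exact_mod_cast hk₁)
    exact_mod_cast (Real.sqrt_pos.2 (by exact_mod_cast hd)).ne'
  exact rigid_of_finrank_center_le_one H ⟨ψ⟩ hΘ₀ h𝔷1 hE₁E hcΘ

/-- **`t(X) ≥ t(A × B)` for `X ∼ (A × B) × Y`**, `A` of Ribet type `(g−1,1)`, `B` without factors of type IV (any `Y`).
[cite: MoonenZarhin1999LowDim, §3 (3.1)] [cite: Ribet1983, Thm. 3] -/
theorem mtRank_hodge_one_le_of_isIsogenous_ribetTypeOne_prod_prod (hX : IsSmoothProjective n X.X) {A B Y : AbelianVariety ℂ} {m : ℕ}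
    (hP : IsSmoothProjective m (A.prod B).X)
    (φ : A ⟶ A) {d : ℕ} (hd : 0 < d) (hφ : φ ≫ φ = -(d • 𝟙 A)) (hAE : Module.finrank ℚ A.endAlgebra = 2)
    (h1 : eigenMultiplicity A φ (Complex.I * (Real.sqrt d : ℂ)) = 1 ∨ eigenMultiplicity A φ (-(Complex.I * (Real.sqrt d : ℂ))) = 1) (hdim : 3 ≤ A.dim)
    (hB4 : HasNoTypeIVFactor B) (hXP : IsIsogenous X ((A.prod B).prod Y)) :
    haveI := BettiUniverse.finite hX 1
    haveI := BettiUniverse.finite hP 1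
    (BettiUniverse.hodge exists_isReal_hodgeModel_holds hP 1).mtRank ≤ (BettiUniverse.hodge exists_isReal_hodgeModel_holds hX 1).mtRank :=
  mtRank_hodge_one_le_of_isIsogenous_prod_of_rigid hX hP (by rw [dim_prod]; omega)
    (hodgeLie_rigid_ribetTypeOne_prod_of_hasNoTypeIVFactor hP φ hd hφ hAE h1 hdim hB4) hXP

end Summit.HodgeConjecture.CorCM

end
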